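import Summits.ResolutionOfSingularities.ResolutionOfSingularities.Theorems.ConeExit.Negative.Mirror
import HarnessLib

/-!
# `WildCones.ConeExit` (stmt-ResolutionOfSingularities-16883), line `critical-plane`: stub `stub_criticalPlane`

THE CRITICAL PLANE. `G := cone p c ∈ κ[X₁ … Xₙ]` is the tangent-cone datum, a CLEANED form of
degree `p = char κ` (no coefficient at an exponent all of whose entries are divisible by `p`), and
`L := Linv p c = {u | G(X + uS) = G(X) + G(u) S^p}` its cone-invariance space. GIVEN the route's
support item `ChernCriticalDirection` as a hypothesis, we prove: if `dL = dim span L ≥ 2` and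
`w ∈ L` has `wᵢ = 1`, then over `K := κ̄` there are a critical direction `ĉ` of `G` and an `ℓ` in
the `K`-span of the image of `L`, both with `i`-th coordinate `0`, with a non-zero `2 × 2` minor.
Consumed by `coneForcing_of` of the line. Steps (aux prefix `critPlane_`):
* (A) linear algebra in `span L` (`critPlane_exists_ell`, `critPlane_map_mem_span`);
* (B) the directional derivatives of `G` vanish along `L`, hence along its `K`-span: differentiate
  the defining identity of `L` in `S` by a chain rule proved by `MvPolynomial.induction_on`
  (`∂_S S^p = 0` in characteristic `p`) and put `S = 0` (`critPlane_sum_mul_aeval_pderiv`);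
* (C) the monomials of `G ⊗ K` avoiding `X_i, X_{j₀}` form a cleaned degree-`p` form `b`; either
  `b = 0`, or cleaning forces two distinct variables, so after `rename` to `Fin s`, `s ≥ 2`, the
  Chern hypothesis gives a critical point `v` of `b` off the coordinates `i, j₀`
  (`critPlane_descend`);
* (D) `v` kills `∂ₖG`, `k ≠ i, j₀` (monomials touching `X_i, X_{j₀}` die at `v` after `∂ₖ`), and
  (B) with `u = ℓ, w` kills `∂_{j₀}G(v)`, `∂ᵢG(v)`; the minor at `(j₀, k₁)`, `v_{k₁} ≠ 0`, is
  `-v_{k₁}`.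

Sources: Hironaka 1970 (additive groups of the tangent cone; bib key Hironaka1970AdditiveGroups);
the critical-point input is the route decl `ChernCriticalDirection` (Jouanolou 1979, Ch. 1), NOT
proved here; everything in this file is elementary commutative algebra over Mathlib.
-/

noncomputable section

-- single-problem summit: the doubled namespace component `ResolutionOfSingularities` is forced
set_option linter.dupNamespace false

open Summit.ResolutionOfSingularities.ResolutionOfSingularities.Theses.WildCones
  (ChernCriticalDirection)
open Summit.ResolutionOfSingularities.ResolutionOfSingularities.Theorems.ConeExit.Negative
  (clean bl ord dv tr step ser pd jac cone Linv dL)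
open scoped BigOperators

namespace Summit.ResolutionOfSingularities.ResolutionOfSingularities.Theorems.WildConesConeExit

open MvPolynomial

/-! ## (B) The chain rule and the directional derivatives of the cone along `L` -/

/-- **Chain rule for `pderiv` through `aeval`** (finitely many variables): for polynomial
substitutions `g : σ → R[τ]`, `∂_t (F ∘ g) = Σ_j (∂_j F ∘ g) · ∂_t g_j`. [folklore] -/
theorem critPlane_pderiv_aeval {σ τ R : Type*} [CommRing R] [Fintype σ]
    (g : σ → MvPolynomial τ R) (t : τ) (F : MvPolynomial σ R) :
    pderiv t (aeval g F) = ∑ j, aeval g (pderiv j F) * pderiv t (g j) := by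
  classical
  induction F using MvPolynomial.induction_on with
  | C a => simp
  | add p q hp hq => simp only [map_add, hp, hq, add_mul, Finset.sum_add_distrib]
  | mul_X q k hq =>
    have h1 : ∀ j, pderiv j (q * X k) = X k * pderiv j q + (if j = k then q else 0) := by
      intro j
      rw [Derivation.leibniz, pderiv_X, smul_eq_mul, smul_eq_mul, Pi.single_apply]
      by_cases h : j = k
      · subst h; simp [add_comm]
      · simp [h, Ne.symm h]
    simp_rw [h1]
    simp only [map_add, map_mul, aeval_X, add_mul, Finset.sum_add_distrib]
    rw [Derivation.leibniz, smul_eq_mul, smul_eq_mul, hq, Finset.mul_sum]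
    simp_rw [apply_ite (aeval g), map_zero, ite_mul, zero_mul, Finset.sum_ite_eq',
      Finset.mem_univ, if_true]
    ring

/-- **The directional derivatives of the cone vanish along `L`**: for `u ∈ Linv p c`
(`char κ = p`) and any point `x` over a `κ`-algebra `K`, `Σ_j u_j · (∂_j cone p c)(x) = 0`.
Differentiate `G(X + uS) = G(X) + G(u) S^p` in `S` (chain rule; `∂_S` of the right side is
`p G(u) S^{p-1} = 0`) and evaluate at `(x, S = 0)` (cf. Hironaka 1970, additive groups of the
tangent cone). [folklore] -/
theorem critPlane_sum_mul_aeval_pderiv {n : ℕ} {κ : Type} [Field κ] (p : ℕ) [CharP κ p]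
    (c : (Fin n → ℕ) → κ) {u : Fin n → κ} (hu : u ∈ Linv p c)
    {K : Type*} [CommRing K] [Algebra κ K] (x : Fin n → K) :
    ∑ j, algebraMap κ K (u j) * aeval x (pderiv j (cone p c)) = 0 := by
  set g : Fin n → MvPolynomial (Option (Fin n)) κ := fun j => X (some j) + C (u j) * X none with hg
  have hE : aeval g (cone p c) = rename some (cone p c) + C (eval u (cone p c)) * X none ^ p := hu
  have hD := congrArg (pderiv none) hE
  have hg' : ∀ j, pderiv none (g j) = C (u j) := fun j => by simp [g]
  have hR1 : pderiv none (rename some (cone p c)) = 0 := by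
    refine pderiv_eq_zero_of_notMem_vars (fun hmem => ?_)
    obtain ⟨i, _, hi⟩ := mem_vars_rename some (cone p c) hmem
    exact Option.some_ne_none i hi
  have hp0 : ((p : ℕ) : MvPolynomial (Option (Fin n)) κ) = 0 := CharP.cast_eq_zero _ p
  rw [critPlane_pderiv_aeval] at hD
  simp only [hg', map_add, hR1, pderiv_C_mul, pderiv_pow, hp0, zero_mul, mul_zero, add_zero] at hD
  -- evaluate at `(x, S = 0)`
  have h := congrArg (aeval fun o : Option (Fin n) => o.elim 0 x) hD
  rw [map_sum, map_zero] at h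
  have hyg : ∀ j, aeval (fun o : Option (Fin n) => o.elim 0 x) (g j) = x j := fun j => by simp [g]
  simp_rw [map_mul, comp_aeval_apply, aeval_C, hyg] at h
  simpa only [mul_comm] using h

/-- `K`-span form of `critPlane_sum_mul_aeval_pderiv`: the directional derivative of the cone at any
point `x` vanishes along every `u'` in the `K`-span of the image of `L`. [folklore] -/
theorem critPlane_sum_mul_aeval_pderiv_of_mem_span {n : ℕ} {κ : Type} [Field κ] (p : ℕ)
    [CharP κ p] (c : (Fin n → ℕ) → κ) {K : Type*} [Field K] [Algebra κ K] (x : Fin n → K)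
    {u' : Fin n → K} (hu' : u' ∈ Submodule.span K
      ((fun (v : Fin n → κ) (k : Fin n) => algebraMap κ K (v k)) '' Linv p c)) :
    ∑ j, u' j * aeval x (pderiv j (cone p c)) = 0 := by
  induction hu' using Submodule.span_induction with
  | mem u' hu' =>
    obtain ⟨u, hu, rfl⟩ := hu'
    exact critPlane_sum_mul_aeval_pderiv p c hu x
  | zero => simp
  | add a b _ _ ha hb => simp [add_mul, Finset.sum_add_distrib, ha, hb]
  | smul r a _ ha => simp [← Finset.mul_sum, mul_assoc, ha]

/-! ## (A) Linear algebra in `span L` -/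

/-- If `dim span L ≥ 2` and `w ∈ L` has `wᵢ = 1`, then `span L` contains an `ℓ` with `ℓᵢ = 0` and
`ℓ_{j₀} = 1` for some `j₀ ≠ i` (normalise an element of `L` off the line `κw`). [folklore] -/
theorem critPlane_exists_ell {n : ℕ} {κ : Type} [Field κ] (L : Set (Fin n → κ)) {w : Fin n → κ}
    {i : Fin n} (h2 : 2 ≤ Module.finrank κ (Submodule.span κ L)) (hw : w ∈ L) (hwi : w i = 1) :
    ∃ (ℓ : Fin n → κ) (j₀ : Fin n), ℓ ∈ Submodule.span κ L ∧ ℓ i = 0 ∧ ℓ j₀ = 1 ∧ j₀ ≠ i := by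
  classical
  have hw0 : w ≠ 0 := fun h => by simp [h] at hwi
  obtain ⟨ℓ₀, hℓ₀L, hℓ₀w⟩ : ∃ ℓ₀ ∈ L, ℓ₀ ∉ Submodule.span κ ({w} : Set (Fin n → κ)) := by
    by_contra hcon
    push Not at hcon
    have h1 := (Submodule.finrank_mono (Submodule.span_le.mpr hcon)).trans_eq
      (finrank_span_singleton hw0)
    omega
  set ℓ₁ : Fin n → κ := ℓ₀ - ℓ₀ i • w with hℓ₁
  have hℓ₁L : ℓ₁ ∈ Submodule.span κ L := Submodule.sub_mem _ (Submodule.subset_span hℓ₀L)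
    (Submodule.smul_mem _ _ (Submodule.subset_span hw))
  have hℓ₁i : ℓ₁ i = 0 := by simp [ℓ₁, hwi]
  have hℓ₁0 : ℓ₁ ≠ 0 := fun h => hℓ₀w (Submodule.mem_span_singleton.mpr
    ⟨ℓ₀ i, by rw [hℓ₁, sub_eq_zero] at h; exact h.symm⟩)
  obtain ⟨j₀, hj₀⟩ : ∃ j₀, ℓ₁ j₀ ≠ 0 := Function.ne_iff.mp hℓ₁0
  refine ⟨(ℓ₁ j₀)⁻¹ • ℓ₁, j₀, Submodule.smul_mem _ _ hℓ₁L, by simp [hℓ₁i], by simp [hj₀], ?_⟩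
  rintro rfl
  exact hj₀ hℓ₁i

/-- Base change of span membership: if `ℓ ∈ span_κ L` then `k ↦ ι (ℓ k)` lies in the `K`-span of the
image of `L` (`ι = algebraMap κ K`; push forward along `ι ∘ -` and restrict scalars). [folklore] -/
theorem critPlane_map_mem_span {n : ℕ} {κ : Type} [Field κ] (L : Set (Fin n → κ)) (K : Type*)
    [Field K] [Algebra κ K] {ℓ : Fin n → κ} (hℓ : ℓ ∈ Submodule.span κ L) :
    (fun k => algebraMap κ K (ℓ k)) ∈
      Submodule.span K ((fun (v : Fin n → κ) (k : Fin n) => algebraMap κ K (v k)) '' L) :=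
  Submodule.span_le_restrictScalars κ K _
    (Submodule.apply_mem_span_image_of_mem_span ((Algebra.linearMap κ K).compLeft (Fin n)) hℓ)

/-! ## (C) The coefficients of the cone, the descended cone and the Chern hypothesis -/

/-- **Coefficients of the cone**: `coeff E (cone p c) = clean p c E` if `|E| = p` and `0` otherwise;
so the cone is a CLEANED form of degree `p`. [folklore] -/
theorem critPlane_coeff_cone {n : ℕ} {κ : Type} [Field κ] (p : ℕ) (c : (Fin n → ℕ) → κ)
    (E : Fin n →₀ ℕ) :
    coeff E (cone p c) = if Finset.sum Finset.univ (fun j => E j) = p then clean p c E else 0 := by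
  unfold cone
  rw [coeff_sum, Finset.sum_eq_single (⇑E : Fin n → ℕ)]
  · by_cases h : Finset.sum Finset.univ (fun j => E j) = p
    · rw [if_pos h, if_pos h, coeff_monomial, if_pos (Finsupp.equivFunOnFinite_symm_coe E)]
    · rw [if_neg h, if_neg h, coeff_zero]
  · intro A _ hA
    by_cases h : Finset.sum Finset.univ (fun j => A j) = p
    · rw [if_pos h, coeff_monomial, if_neg]
      intro hAE
      apply hA
      rw [← hAE, Finsupp.coe_equivFunOnFinite_symm]
    · rw [if_neg h, coeff_zero]
  · intro hE
    have hsum : ¬ Finset.sum Finset.univ (fun j => E j) = p := by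
      intro hsum
      refine hE (Fintype.mem_piFinset.mpr (fun j => Finset.mem_range.mpr ?_))
      have : E j ≤ Finset.sum Finset.univ (fun j => E j) :=
        Finset.single_le_sum (fun _ _ => Nat.zero_le _) (Finset.mem_univ j)
      omega
    simp [hsum]

/-- If every exponent of a sum of monomials is positive at some variable `m ≠ k` where the point
`x` vanishes, then `∂_k` of the sum vanishes at `x` (`∂_k` keeps the `X_m`-exponent). [folklore] -/
theorem critPlane_eval_pderiv_sum_monomial {σ R : Type*} [CommSemiring R] (S : Finset (σ →₀ ℕ))
    (a : (σ →₀ ℕ) → R) (x : σ → R) (k : σ)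
    (h : ∀ E ∈ S, ∃ m, m ≠ k ∧ E m ≠ 0 ∧ x m = 0) :
    eval x (pderiv k (∑ E ∈ S, monomial E (a E))) = 0 := by
  classical
  rw [map_sum, map_sum]
  refine Finset.sum_eq_zero (fun E hE => ?_)
  obtain ⟨m, hmk, hEm, hxm⟩ := h E hE
  rw [pderiv_monomial, eval_monomial]
  have hm : (E - Finsupp.single k 1 : σ →₀ ℕ) m ≠ 0 := by
    rw [Finsupp.tsub_apply, Finsupp.single_apply, if_neg (Ne.symm hmk), Nat.sub_zero]
    exact hEm
  rw [Finsupp.prod, Finset.prod_eq_zero (Finsupp.mem_support_iff.mpr hm), mul_zero]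
  rw [hxm, zero_pow hm]

/-- **Descent to `Fin s` and the Chern hypothesis.** Let `b ∈ K[X₁ … Xₙ]` (`K` algebraically
closed of odd characteristic `p`, `n ≥ 3`) be a form of degree `p` whose exponents avoid
`X_i, X_{j₀}` and are never all divisible by `p`. Then some `v ≠ 0` with `vᵢ = v_{j₀} = 0` kills
every `∂_k b`, `k ≠ i, j₀`: if `b = 0` take a coordinate vector; otherwise cleaning forces two
distinct variables, so `b = rename f H` for the enumeration `f : Fin s ↪ Fin n` of the other
coordinates, `s ≥ 2`, and `ChernCriticalDirection` applies to `H`. [folklore] -/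
theorem critPlane_descend (hC : ChernCriticalDirection) {p : ℕ} (hp : p.Prime) (hp2 : p ≠ 2)
    {n : ℕ} (hn : 3 ≤ n) (K : Type) [Field K] [CharP K p] [IsAlgClosed K]
    {i j₀ : Fin n} (hij : j₀ ≠ i) (b : MvPolynomial (Fin n) K) (hhom : b.IsHomogeneous p)
    (hsupp : ∀ E ∈ b.support, E i = 0 ∧ E j₀ = 0) (hcl : ∀ E ∈ b.support, ¬ ∀ j, p ∣ E j) :
    ∃ v : Fin n → K, v i = 0 ∧ v j₀ = 0 ∧ v ≠ 0 ∧
      ∀ k, k ≠ i → k ≠ j₀ → eval v (pderiv k b) = 0 := by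
  classical
  set T : Finset (Fin n) := (Finset.univ.erase i).erase j₀ with hT
  have hmemT : ∀ k, k ∈ T ↔ k ≠ i ∧ k ≠ j₀ := by
    intro k
    simp only [T, Finset.mem_erase, Finset.mem_univ, and_true]
    exact ⟨fun h => ⟨h.2, h.1⟩, fun h => ⟨h.2, h.1⟩⟩
  have hcardT : T.card = n - 2 := by
    have hj : j₀ ∈ Finset.univ.erase i := Finset.mem_erase.mpr ⟨hij, Finset.mem_univ _⟩
    rw [hT, Finset.card_erase_of_mem hj, Finset.card_erase_of_mem (Finset.mem_univ i),
      Finset.card_univ, Fintype.card_fin]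
    omega
  have hsubT : ∀ E ∈ b.support, ∀ j, E j ≠ 0 → j ∈ T := by
    intro E hE j hj
    obtain ⟨hi0, hj0⟩ := hsupp E hE
    exact (hmemT j).mpr ⟨fun h => hj (h ▸ hi0), fun h => hj (h ▸ hj0)⟩
  by_cases hb : b = 0
  · have hTne : T.Nonempty := by rw [← Finset.card_pos, hcardT]; omega
    obtain ⟨k₁, hk₁⟩ := hTne
    obtain ⟨hk₁i, hk₁j⟩ := (hmemT k₁).mp hk₁
    refine ⟨Pi.single k₁ 1, by simp [Ne.symm hk₁i], by simp [Ne.symm hk₁j], fun h => ?_,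
      fun k _ _ => by simp [hb]⟩
    simpa using congrFun h k₁
  · -- cleaning forces two distinct variables in some exponent of `b`, so `2 ≤ card T`
    obtain ⟨E, hE⟩ := ne_zero_iff.mp hb
    have hEs : E ∈ b.support := mem_support_iff.mpr hE
    obtain ⟨j₁, hj₁⟩ : ∃ j₁, ¬ p ∣ E j₁ := not_forall.mp (hcl E hEs)
    have hEj₁0 : E j₁ ≠ 0 := fun h => hj₁ (h ▸ dvd_zero p)
    have hEj₁p : E j₁ ≠ p := fun h => hj₁ (h ▸ dvd_refl p)
    have hdeg : ∑ j, E j = p := by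
      rw [← Finsupp.degree_eq_sum, Finsupp.degree_eq_weight_one]
      exact hhom hE
    obtain ⟨j₂, hj₂1, hj₂⟩ : ∃ j₂, j₂ ≠ j₁ ∧ E j₂ ≠ 0 := by
      by_contra hcon
      push Not at hcon
      apply hEj₁p
      rw [← hdeg, Finset.sum_eq_single j₁ (fun j _ hj => hcon j hj)
        (fun h => absurd (Finset.mem_univ _) h)]
    have hs : 2 ≤ T.card := by
      rw [← Finset.card_pair hj₂1.symm]
      refine Finset.card_le_card (fun j hj => ?_)
      simp only [Finset.mem_insert, Finset.mem_singleton] at hj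
      rcases hj with rfl | rfl
      exacts [hsubT E hEs _ hEj₁0, hsubT E hEs _ hj₂]
    -- descend along the enumeration `f` of `T`
    let f : Fin T.card ↪o Fin n := T.orderEmbOfFin rfl
    have hfr : Set.range f = ↑T := Finset.range_orderEmbOfFin T rfl
    have hvars : ↑b.vars ⊆ Set.range f := by
      intro m hm
      rw [hfr, Finset.mem_coe]
      obtain ⟨E', hE', hmE'⟩ := (mem_vars_iff_mem_support m).mp (Finset.mem_coe.mp hm)
      exact hsubT E' hE' m (Finsupp.mem_support_iff.mp hmE')
    obtain ⟨H, hH⟩ := exists_rename_eq_of_vars_subset_range b f f.injective hvars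
    have hH0 : H ≠ 0 := by
      rintro rfl
      exact hb (by rw [← hH, map_zero])
    have hHhom : H.IsHomogeneous p := by
      rw [← IsHomogeneous.rename_isHomogeneous_iff f.injective, hH]
      exact hhom
    obtain ⟨v', hv'0, hv'⟩ := hC p hp hp2 T.card hs K H hHhom hH0
    have hnot : ∀ k, k ∉ T → ¬ ∃ m, f m = k := by
      rintro k hk ⟨m, rfl⟩
      exact hk (Finset.orderEmbOfFin_mem T rfl m)
    refine ⟨Function.extend f v' 0, ?_, ?_, ?_, ?_⟩
    · exact (Function.extend_apply' _ _ _ (hnot i fun h => ((hmemT i).mp h).1 rfl)).trans rfl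
    · exact (Function.extend_apply' _ _ _ (hnot j₀ fun h => ((hmemT j₀).mp h).2 rfl)).trans rfl
    · intro h
      apply hv'0
      funext m
      have h1 := congrFun h (f m)
      rwa [f.injective.extend_apply] at h1
    · intro k hki hkj
      obtain ⟨m, rfl⟩ : k ∈ Set.range f := by rw [hfr]; exact (hmemT k).mpr ⟨hki, hkj⟩
      rw [← hH, pderiv_rename f.injective, eval_rename,
        show Function.extend f v' 0 ∘ f = v' from funext fun m => f.injective.extend_apply _ _ _]
      exact hv' m

/-- **(C) + (D): a critical direction off the coordinates `i, j₀`.** Over an algebraically closed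
`κ`-algebra `K` of characteristic `p` there is `v ≠ 0` with `vᵢ = v_{j₀} = 0` at which every
`∂_k cone p c`, `k ≠ i, j₀`, vanishes: split `cone ⊗ K = b + r` into the monomials avoiding /
touching `X_i, X_{j₀}`; `b` is cleaned of degree `p` (`critPlane_coeff_cone`) and handled by
`critPlane_descend`, and `∂_k r` dies at `v` termwise. [folklore] -/
theorem critPlane_critical_off (hC : ChernCriticalDirection) {p : ℕ} (hp : p.Prime) (hp2 : p ≠ 2)
    {n : ℕ} (hn : 3 ≤ n) {κ : Type} [Field κ] (c : (Fin n → ℕ) → κ)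
    (K : Type) [Field K] [Algebra κ K] [CharP K p] [IsAlgClosed K]
    {i j₀ : Fin n} (hij : j₀ ≠ i) :
    ∃ v : Fin n → K, v i = 0 ∧ v j₀ = 0 ∧ v ≠ 0 ∧
      ∀ k, k ≠ i → k ≠ j₀ → aeval v (pderiv k (cone p c)) = 0 := by
  classical
  set GK : MvPolynomial (Fin n) K := map (algebraMap κ K) (cone p c) with hGK
  let P : (Fin n →₀ ℕ) → Prop := fun E => E i = 0 ∧ E j₀ = 0
  set b : MvPolynomial (Fin n) K := ∑ E ∈ GK.support.filter P, monomial E (coeff E GK) with hb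
  have hcoeffb : ∀ E, coeff E b = if E ∈ GK.support.filter P then coeff E GK else 0 := by
    intro E
    rw [hb, coeff_sum]
    simp_rw [coeff_monomial]
    rw [Finset.sum_ite_eq']
  have hfacts : ∀ E ∈ b.support, P E ∧ (∑ j, E j = p) ∧ ¬ ∀ j, p ∣ E j := by
    intro E hE
    rw [mem_support_iff, hcoeffb] at hE
    by_cases h : E ∈ GK.support.filter P
    · rw [if_pos h, hGK, coeff_map] at hE
      have h' : coeff E (cone p c) ≠ 0 := fun h0 => hE (by rw [h0, map_zero])
      rw [critPlane_coeff_cone] at h'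
      by_cases hs : ∑ j, E j = p
      · rw [if_pos hs] at h'
        refine ⟨(Finset.mem_filter.mp h).2, hs, fun hdvd => h' ?_⟩
        unfold clean
        rw [if_pos hdvd]
      · exact absurd (if_neg hs) h'
    · exact absurd (if_neg h) hE
  have hhom : b.IsHomogeneous p := by
    intro E hE
    have hdeg : E.degree = p := by
      rw [Finsupp.degree_eq_sum]
      exact (hfacts E (mem_support_iff.mpr hE)).2.1
    rw [Finsupp.degree_eq_weight_one] at hdeg
    exact hdeg
  obtain ⟨v, hvi, hvj, hv0, hvT⟩ := critPlane_descend hC hp hp2 hn K hij b hhom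
    (fun E hE => (hfacts E hE).1) (fun E hE => (hfacts E hE).2.2)
  refine ⟨v, hvi, hvj, hv0, fun k hki hkj => ?_⟩
  rw [MvPolynomial.aeval_def, MvPolynomial.eval₂_eq_eval_map, ← pderiv_map, ← hGK]
  have hsplit : GK = b + ∑ E ∈ GK.support.filter (fun E => ¬ P E), monomial E (coeff E GK) := by
    rw [hb, Finset.sum_filter_add_sum_filter_not]
    exact GK.as_sum
  rw [hsplit, map_add, map_add, hvT k hki hkj, zero_add]
  refine critPlane_eval_pderiv_sum_monomial _ _ _ _ (fun E hE => ?_)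
  have hnP : ¬ P E := (Finset.mem_filter.mp hE).2
  by_cases hEi : E i = 0
  · exact ⟨j₀, fun h => hkj h.symm, fun h => hnP ⟨hEi, h⟩, hvj⟩
  · exact ⟨i, fun h => hki h.symm, hEi, hvi⟩

/-! ## The stub -/

/-- **STUB `stub_criticalPlane` (the critical plane, GIVEN the Chern lemma).** For `p` an odd prime,
`n ≥ 3`, `κ` of characteristic `p`: if `dL p c ≥ 2` and `w ∈ Linv p c` has `wᵢ = 1`, then over
`κ̄ = AlgebraicClosure κ` there are a critical direction `ĉ` of `cone p c` (all `∂ₖ` vanish at `ĉ`)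
and an `ℓ` in the `κ̄`-span of the image of `Linv p c`, both with `i`-th coordinate `0`, with a
non-zero `2 × 2` minor `ĉ_j ℓ_{j'} - ĉ_{j'} ℓ_j`. Assembly: `ĉ := v` from `critPlane_critical_off`,
`ℓ := ι ∘ ℓ₂` from `critPlane_exists_ell`; `∂_{j₀}` and `∂ᵢ` die at `v` by the vanishing of the
directional derivatives along `ℓ` and `w`; the minor at `(j₀, k₁)`, `v_{k₁} ≠ 0`, is `-v_{k₁}`.
[folklore] -/
theorem stub_criticalPlane : ChernCriticalDirection → ∀ (p : ℕ), p.Prime → p ≠ 2 → ∀ (n : ℕ), 3 ≤ n → ∀ (κ : Type) [Field κ] [CharP κ p] (c : (Fin n → ℕ) → κ) (i : Fin n) (w : Fin n → κ), 2 ≤ dL p c → w ∈ Linv p c → w i = 1 → ∃ (ĉ ℓ : Fin n → AlgebraicClosure κ) (j j' : Fin n), (∀ k : Fin n, MvPolynomial.aeval ĉ (MvPolynomial.pderiv k (cone p c)) = 0) ∧ ℓ ∈ Submodule.span (AlgebraicClosure κ) ((fun (v : Fin n → κ) (k : Fin n) => algebraMap κ (AlgebraicClosure κ) (v k)) '' Linv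 p c) ∧ ĉ i = 0 ∧ ℓ i = 0 ∧ ĉ j * ℓ j' - ĉ j' * ℓ j ≠ 0 := by
  intro hC p hp hp2 n hn κ _ _ c i w hd hw hwi
  classical
  haveI : CharP (AlgebraicClosure κ) p :=
    charP_of_injective_algebraMap (algebraMap κ (AlgebraicClosure κ)).injective p
  obtain ⟨ℓ₂, j₀, hℓ₂L, hℓ₂i, hℓ₂j, hj₀i⟩ := critPlane_exists_ell (Linv p c) hd hw hwi
  obtain ⟨v, hvi, hvj, hv0, hvT⟩ :=
    critPlane_critical_off hC hp hp2 hn c (AlgebraicClosure κ) hj₀i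
  set ℓ : Fin n → AlgebraicClosure κ := fun k => algebraMap κ _ (ℓ₂ k) with hℓdef
  have hℓ : ℓ ∈ Submodule.span (AlgebraicClosure κ) ((fun (v : Fin n → κ) (k : Fin n) =>
      algebraMap κ (AlgebraicClosure κ) (v k)) '' Linv p c) :=
    critPlane_map_mem_span (Linv p c) (AlgebraicClosure κ) hℓ₂L
  have hℓi : ℓ i = 0 := by simp [ℓ, hℓ₂i]
  have hℓj : ℓ j₀ = 1 := by simp [ℓ, hℓ₂j]
  have hsumw := critPlane_sum_mul_aeval_pderiv p c hw v
  have hsumℓ := critPlane_sum_mul_aeval_pderiv_of_mem_span p c v hℓ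
  have hj₀ : aeval v (pderiv j₀ (cone p c)) = 0 := by
    rw [Finset.sum_eq_single j₀] at hsumℓ
    · rw [hℓj, one_mul] at hsumℓ
      exact hsumℓ
    · intro k _ hk
      by_cases hki : k = i
      · rw [hki, hℓi, zero_mul]
      · rw [hvT k hki hk, mul_zero]
    · exact fun h => absurd (Finset.mem_univ _) h
  have hi : aeval v (pderiv i (cone p c)) = 0 := by
    rw [Finset.sum_eq_single i] at hsumw
    · rw [hwi, map_one, one_mul] at hsumw
      exact hsumw
    · intro k _ hk
      by_cases hkj : k = j₀
      · rw [hkj, hj₀, mul_zero]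
      · rw [hvT k hk hkj, mul_zero]
    · exact fun h => absurd (Finset.mem_univ _) h
  have hcrit : ∀ k, aeval v (pderiv k (cone p c)) = 0 := by
    intro k
    by_cases hki : k = i
    · rw [hki]; exact hi
    by_cases hkj : k = j₀
    · rw [hkj]; exact hj₀
    exact hvT k hki hkj
  obtain ⟨k₁, hk₁⟩ : ∃ k₁, v k₁ ≠ 0 := Function.ne_iff.mp hv0
  refine ⟨v, ℓ, j₀, k₁, hcrit, hℓ, hvi, hℓi, ?_⟩
  rw [hvj, hℓj, zero_mul, mul_one, zero_sub, neg_ne_zero]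
  exact hk₁

end Summit.ResolutionOfSingularities.ResolutionOfSingularities.Theorems.WildConesConeExit

end
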